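import Summits.QuantumFields.BalabanUV.Beta.FP.AveragingJetLettersRootedSecond

/-!
# `Beta/FP/ScalarAveragingJetLetters` — road «FP» (binder row D1), row **(GH-a) COUNTING, piece (g4)** «the four scalar constraint loops in MIX mass
# currency»: the **0-FORM (scalar block mean `Q′_B`) ROOTED BLOCK FAMILY** at blocking `n` — the SITE twin of RHOA-6b′'s bond families
# `AveragingJetLettersRooted.blkW ∕ blkFld ∕ blkBg` — and its first∕second averaging-jet letters (SUP ∕ MASS ∕ SUPPORT ∕ windowed (M), (M₂)) as INSTANCES of the
# generic §1 of `AveragingJetLettersRooted(Second)` and of `WindowedBlockMass.windowedMass_le_half` BY NAME ([folklore] finite bookkeeping; no road object)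

HONEST FRAMING (cell `pub-balaban`, β sub-cell, verbatim): discharging `BetaPertH` makes Bałaban's UV stability UNCONDITIONAL — a real constructive-QFT
result; it is NOT the continuum limit and NOT the Clay problem.  THIS MODULE discharges NOTHING of the series, of row D1, of `hbook`∕`hasym`∕`ρ_n`∕`Mix_n`∕(GH-a):
it is [folklore] finite bookkeeping (`Finset` sums, one `n⁻⁴` count) over node 6 «ADJOINT-TRANSPORT-JETS» (`Beta.AdjointTransportJets.avgPath`∕`avgJet₁`∕`avgJet₂`),
the road's block index set `AxialBlockWeights.fineBlock` (`card_fineBlock`) and the GENERIC rooted-family letters of `FP/AveragingJetLettersRooted` (`wfld`, `ker₁`,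
`mass₁`, `ker₁_le_mul_wfld`, `sum_sum_ker₁_le`, `sum_mass₁_le`, `sum_ker₁_le_mul_wfld`, `exists_of_ker₁_ne_zero`, `avgJet₁_eq_sum_ker₁`), `FP/AveragingJetLettersRootedSecond`
(`ker₂`, `ker₂_le_mul_wfld`, `sum_ker₂_outer_le`, `avgJet₂_eq_sum_ker₂`) and `FP/WindowedBlockMass` (`windowedMass_le_half`, `exists_of_mass₁_ne_zero`) BY NAME.
«not in print; our bookkeeping».  0 estimates of any Bałaban propagator; NO road object is identified here (B12 p.251–252 (0.3)∕(0.4) and B5-I (1.11)∕(1.70) are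
LOCATORS for which object is modelled: the scalar block mean with parallel transport along rooted radial contours).
HONEST DEPENDENCY: continuum YM on T⁴ ⇐ BetaPertH ∧ nine spine estimates (0/9 proved); BetaPertH ⇐ (D1) ∧ (D4) ∧ CAP+tail; G-an2-4 gates asym, D1 and NE2/3/4.

ABSOLUTE RULE (cell charter, verbatim): «No internally-minted statement may enter as a cited fact. Every hypothesis is either kernel-proved in this package or a
verbatim quotation of a PUBLISHED theorem with page reference. The manuscript(s) under audit are NOT citable for their own disputed steps — they are the thing under
adjudication; programme-internal (2001/route/tribunal) claims are never citable.»  Accordingly: no `def … : Prop`, no citation tag, no hypothesis is a printed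
statement; the three data `def`s below (`sclW`, `sclFld`, `sclBg`) assert nothing.

THE ROW (road-FP OWNER b2b-balaban-beta-d1-p3, `LEAVES-FP.md` row (GH-a) COUNTING (R-FP-28 (d)), piece (g4) «the four scalar constraint loops = MIX-3∕2∕1∕4 shapes in
MASS currency BY NAME»; owner ruling (d) verbatim: «the scalar averaging-jet letters are NOT a new row (RHOA-6b′ ✓ `AveragingJetLettersRooted` specialised to the 0-form
transport, inside (GH-a))»).  THIS FILE is that specialisation; its consumer is the (g4) instance file `FP/GhostLoopCountingMix` (the ghost twin of the owner's
(INST-MIX) row `FP/MixLoopInstanceBlockFamily`).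

WHAT IS TYPED (one-sided convention of `FP/AveragingJetLetters`: an EVENT carries a weight, a FIELD LEG and a BACKGROUND WORD).
* §1 THE 0-FORM ROOTED BLOCK FAMILY at blocking `n` on `Pt = ℤ⁴` (radial-rule generic): rules `σ : Σ` (a `Fintype`) with probabilities `p σ`, events `(x′, σ)` with
  `x′ ∈ fineBlock n` a SITE of the block, weight **`sclW = n⁻⁴·p σ`** (the block MEAN), field leg **`sclFld = n•y + x′`** (the SITE carrying the scalar fluctuation
  letter — NO straight segment, unlike the bond family), word **`sclBg = rad σ y x′`** (the radial word root → site, labels `B`); `sclW_nonneg`, `sum_sclW`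
  (`Σ_e ω e = Σ_σ p σ`, `#fineBlock n = n⁴`), **`wfld_scl_le`** (`wfld c ≤ n⁻⁴·Σ_σ p σ`: at most ONE block site sits at a field point), `length_sclBg_le` (`≤ ℓ₀` from
  the displayed radial letter `|rad σ y x′| ≤ ℓ₀`); the letters AS INSTANCES: **`scl_sup_le`** (`ker₁ b c ≤ M·n⁻⁴·Σp` under multiplicity `count b (rad …) ≤ M`),
  `scl_sup_le_one` (simple radial words), **`scl_mass_le`** (`Σ_{b∈S}Σ_{c∈T} ker₁ ≤ ℓ₀·Σp`, ALL finite windows), `scl_massFun_le` (`Σ_{b∈S} mass₁ b ≤ ℓ₀·Σp`),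
  **`scl_fieldMass_le`** (`Σ_{b∈S} ker₁ b c ≤ ℓ₀·n⁻⁴·Σp`), **`scl_support`** (`ker₁ b c ≠ 0 ⟹ ∃ x′ ∈ fineBlock n, ∃ σ, n•y + x′ = c ∧ b ∈ rad σ y x′`).
* §2 THE WINDOWED LETTERS BY NAME: `scl_mass₁_local` ((L): a nonzero `mass₁^{(u)} ℓ` forces `‖pos ℓ − n•u‖∞ ≤ R₀·n` from the DISPLAYED radial radius letter
  `ℓ ∈ rad σ u x′ → ‖pos ℓ − n•u‖∞ ≤ R₀·n`), **`scl_windowedMass_le_half`** ((M) at half rate, RHOA-6c′'s shape: `Σ_{ℓ∈S} e^{−(δ∕(2n))‖pos ℓ − c‖∞}·Σ_{u∈Y} mass₁^{(u)} ℓ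
  ≤ (ℓ₀·Σp)·e^{δR₀∕2}·(e^{δ∕2}(1+480e^{δ∕4}(4∕δ)⁴))`, ALL finite `S`, `Y`, every centre `c`); second jet: `scl_ker₂_sup_le` (`≤ 2M²·n⁻⁴·Σp`), **`scl_ker₂_outer_le`**
  (`Σ_{ℓ∈S}Σ_{b′∈S′}Σ_{c∈T} ker₂ ℓ b′ c ≤ 2ℓ₀·(ℓ₀·Σp)`), **`scl_windowedMass₂_le_half`** ((M₂): `≤ (2ℓ₀·(ℓ₀·Σp))·e^{δR₀∕2}·(…)`).
* §3 KERNEL FORMS (node 6 BY NAME): `hasDerivAt_sclAvg_zero`, `sclJet₁_eq_sum_ker₁`, `sclJet₂_eq_sum_ker₂`.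
WHERE THE `n` SITS (displayed, not hidden): total weight `Σ_σ p σ` (NOT pinned to 1), total insertion mass `ℓ₀·Σ_σ p σ` (NO `+n`: no straight segment); with the
radial length `ℓ₀ ≤ (2d+2)·n` of a comb ∕ staircase rule the windowed letter is `≍ n·Σp` — the instance number, the normalisation of `Q′` (block MEAN `n⁻⁴` here vs block
SUM) and the matching normalisation of the scalar minimiser's columns are row (GH-a)'s ∕ KER-γ (γ)'s bookkeeping, not decided here.
NOT TYPED HERE (scope): the radial rules themselves (comb `gammaCAt (ctr n)`'s words, B12 (0.4)'s S_D-orbit of staircases); the identification of this family's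
`avgPath` with Bałaban's `Q′(U)` beyond node 6's kernel form; (MIX) power counting; `Mix_n = O(1)`; (GH-a); `hbook`; D1; BetaPertH.  Nothing printed is asserted.
Provenance: D1 formalisation swarm, unit `b2b-balaban-beta-d1-formalise-leaf-05` gen 14 (prover-…-leaf-05-g14-0), 2026-08-21, first refusal on (GH-a) (g4) exercised
(journal INTENT 2026-08-21T03:56:26Z); no existing file touched.
-/

noncomputable section

namespace Summit.QuantumFields.BalabanUV.Beta.FP.ScalarAveragingJetLetters

open Finset
open scoped BigOperators
open Literature.MathematicalPhysics.QuantumFieldTheory.Balaban1983to89.Beta.DyadicShell (Pt supNorm)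
open Literature.MathematicalPhysics.QuantumFieldTheory.Balaban1983to89.Beta.AxialBlockWeights (fineBlock mem_fineBlock card_fineBlock)
open Literature.MathematicalPhysics.QuantumFieldTheory.Balaban1983to89.Beta.AdjointTransportJets (avgPath avgJet₁ avgJet₂ hasDerivAt_avgPath_zero)
open Summit.QuantumFields.BalabanUV.Beta.FP.AveragingJetLettersSecond (dc)
open Summit.QuantumFields.BalabanUV.Beta.FP.AveragingJetLettersRooted
  (wfld ker₁ mass₁ ker₁_nonneg mass₁_nonneg ker₁_le_mul_wfld sum_sum_ker₁_le sum_mass₁_le sum_ker₁_le_mul_wfld exists_of_ker₁_ne_zero avgJet₁_eq_sum_ker₁)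
open Summit.QuantumFields.BalabanUV.Beta.FP.AveragingJetLettersRootedSecond
  (ker₂ ker₂_nonneg ker₂_le_mul_wfld sum_ker₂_outer_le avgJet₂_eq_sum_ker₂)
open Summit.QuantumFields.BalabanUV.Beta.FP.WindowedBlockMass (windowedMass_le_half exists_of_mass₁_ne_zero)

/-! ## §1 The 0-form rooted block family at blocking `n` (radial-rule generic) -/

section Scalar

variable {σ : Type*} [Fintype σ] {B : Type*} [DecidableEq B]

/-- [our object] the event weight `n⁻⁴ · p σ` of the 0-form block family (the block MEAN over the `n⁴` sites). -/
def sclW (n : ℕ) (p : σ → ℝ) (e : ↥(fineBlock n) × σ) : ℝ := ((n : ℝ) ^ 4)⁻¹ * p e.2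

/-- [our object] the field leg of the event `(x′, σ)` of block `y`: the SITE `n•y + x′` carrying the scalar fluctuation letter. -/
def sclFld (n : ℕ) (y : Pt) (e : ↥(fineBlock n) × σ) : Pt := n • y + e.1.1

/-- [our object] the background word of `(x′, σ)`: the radial word `rad σ y x′` (root → site, rule `σ`), labels `B`; no straight segment. -/
def sclBg (n : ℕ) (y : Pt) (rad : σ → Pt → Pt → List B) (e : ↥(fineBlock n) × σ) : List B := rad e.2 y e.1.1

omit [Fintype σ] in
/-- [folklore] the weights are nonnegative for nonnegative probabilities. -/
theorem sclW_nonneg (n : ℕ) {p : σ → ℝ} (hp : ∀ s, 0 ≤ p s) (e : ↥(fineBlock n) × σ) : 0 ≤ sclW n p e :=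
  mul_nonneg (by positivity) (hp e.2)

/-- [folklore] TOTAL WEIGHT: `Σ_e sclW e = Σ_σ p σ` (`#fineBlock n = n⁴`, `n ≥ 1`). -/
theorem sum_sclW {n : ℕ} (hn : 1 ≤ n) (p : σ → ℝ) : ∑ e, sclW n p e = ∑ s, p s := by
  unfold sclW
  rw [Fintype.sum_prod_type]
  simp only [Finset.sum_const, Finset.card_univ, Fintype.card_coe, card_fineBlock]
  have hn' : (n : ℝ) ≠ 0 := by exact_mod_cast (by omega : n ≠ 0)
  rw [← Finset.mul_sum, nsmul_eq_mul, ← mul_assoc, Nat.cast_pow, mul_inv_cancel₀ (pow_ne_zero _ hn'), one_mul]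

/-- [folklore] **THE `n⁻⁴` COUNT**: at most ONE block site sits at a field point, so `wfld c ≤ n⁻⁴ · Σ_σ p σ` (`p ≥ 0`, `n ≥ 1`). -/
theorem wfld_scl_le {n : ℕ} (hn : 1 ≤ n) (y : Pt) {p : σ → ℝ} (hp : ∀ s, 0 ≤ p s) (c : Pt) :
    wfld (sclW n p) (sclFld (σ := σ) n y) c ≤ ((n : ℝ) ^ 4)⁻¹ * ∑ s, p s := by
  classical
  unfold wfld sclW sclFld
  have hP : 0 ≤ ∑ s, p s := Finset.sum_nonneg fun s _ => hp s
  rw [Finset.sum_filter, Fintype.sum_prod_type]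
  have hinner : ∀ x : ↥(fineBlock n), (∑ s : σ, if n • y + x.1 = c then ((n : ℝ) ^ 4)⁻¹ * p s else 0)
      = if n • y + x.1 = c then ((n : ℝ) ^ 4)⁻¹ * ∑ s, p s else 0 := fun x => by
    split_ifs with h
    · rw [Finset.mul_sum]
    · simp
  simp_rw [hinner]
  rw [← Finset.sum_filter, Finset.sum_const, nsmul_eq_mul]
  set A := (univ : Finset ↥(fineBlock n)).filter (fun x => n • y + x.1 = c) with hA
  have hcard : A.card ≤ 1 := by
    refine Finset.card_le_one.mpr fun x₁ hx₁ x₂ hx₂ => Subtype.ext ?_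
    have h1 := (Finset.mem_filter.mp hx₁).2
    have h2 := (Finset.mem_filter.mp hx₂).2
    exact add_left_cancel (h1.trans h2.symm)
  have hcard' : (A.card : ℝ) ≤ 1 := by exact_mod_cast hcard
  have _hn : (0 : ℝ) < n := by exact_mod_cast hn
  calc (A.card : ℝ) * (((n : ℝ) ^ 4)⁻¹ * ∑ s, p s) ≤ 1 * (((n : ℝ) ^ 4)⁻¹ * ∑ s, p s) :=
        mul_le_mul_of_nonneg_right hcard' (by positivity)
    _ = ((n : ℝ) ^ 4)⁻¹ * ∑ s, p s := one_mul _

omit [Fintype σ] [DecidableEq B] in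
/-- [folklore] WORD LENGTH: a radial letter `|rad σ y x′| ≤ ℓ₀` gives `|sclBg e| ≤ ℓ₀` (no straight part). -/
theorem length_sclBg_le {n : ℕ} (y : Pt) {rad : σ → Pt → Pt → List B} {ℓ₀ : ℕ}
    (hrad : ∀ s x', (rad s y x').length ≤ ℓ₀) (e : ↥(fineBlock n) × σ) :
    (sclBg n y rad e).length ≤ ℓ₀ :=
  hrad e.2 e.1.1

variable {n : ℕ} {y : Pt} {p : σ → ℝ} {rad : σ → Pt → Pt → List B} {ℓ₀ : ℕ}

/-- [folklore] **THE SUP LETTER, instance**: multiplicity `count b (sclBg e) ≤ M` ⟹ `ker₁ b c ≤ M · n⁻⁴ · Σ_σ p σ`. -/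
theorem scl_sup_le (hn : 1 ≤ n) (hp : ∀ s, 0 ≤ p s) {M : ℕ} {b : B}
    (hM : ∀ e, (sclBg n y rad e).count b ≤ M) (c : Pt) :
    ker₁ (sclW n p) (sclFld n y) (sclBg n y rad) b c ≤ (M : ℝ) * (((n : ℝ) ^ 4)⁻¹ * ∑ s, p s) :=
  (ker₁_le_mul_wfld (sclW_nonneg n hp) hM c).trans
    (mul_le_mul_of_nonneg_left (wfld_scl_le hn y hp c) (Nat.cast_nonneg _))

/-- [folklore] **THE SUP LETTER for SIMPLE radial words**: `rad σ y x′` without repeated letters ⟹ `ker₁ b c ≤ n⁻⁴·Σ_σ p σ`. -/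
theorem scl_sup_le_one (hn : 1 ≤ n) (hp : ∀ s, 0 ≤ p s) (hrad : ∀ s x', (rad s y x').Nodup) (b : B) (c : Pt) :
    ker₁ (sclW n p) (sclFld n y) (sclBg n y rad) b c ≤ ((n : ℝ) ^ 4)⁻¹ * ∑ s, p s := by
  have h := scl_sup_le hn hp (M := 1) (b := b)
    (fun e => List.nodup_iff_count_le_one.mp (hrad e.2 e.1.1) b) c (n := n) (rad := rad) (y := y)
  simpa using h

/-- [folklore] **THE MASS LETTER, instance (the count `n⁻⁴·Σ_{x′}|path|`)**: `Σ_{b∈S} Σ_{c∈T} ker₁ b c ≤ ℓ₀ · Σ_σ p σ`, ALL finite windows. -/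
theorem scl_mass_le (hn : 1 ≤ n) (hp : ∀ s, 0 ≤ p s) (hrad : ∀ s x', (rad s y x').length ≤ ℓ₀)
    (S : Finset B) (T : Finset Pt) :
    ∑ b ∈ S, ∑ c ∈ T, ker₁ (sclW n p) (sclFld n y) (sclBg n y rad) b c ≤ ((ℓ₀ : ℕ) : ℝ) * ∑ s, p s := by
  rw [← sum_sclW hn p]
  exact sum_sum_ker₁_le (sclW_nonneg n hp) (length_sclBg_le y hrad) S T

/-- [folklore] **THE MASS-FUNCTION WINDOW LETTER per coarse site `y`, instance**: `Σ_{b∈window} mass₁ b ≤ ℓ₀ · Σ_σ p σ` for EVERY finite window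
(the per-block total that instantiates RHOA-6c′'s exponentially windowed (M)-letter). -/
theorem scl_massFun_le (hn : 1 ≤ n) (hp : ∀ s, 0 ≤ p s) (hrad : ∀ s x', (rad s y x').length ≤ ℓ₀)
    (S : Finset B) :
    ∑ b ∈ S, mass₁ (sclW n p) (sclBg n y rad) b ≤ ((ℓ₀ : ℕ) : ℝ) * ∑ s, p s := by
  rw [← sum_sclW hn p]
  exact sum_mass₁_le (sclW_nonneg n hp) (length_sclBg_le y hrad) S

/-- [folklore] **THE FIELD-SIDE MASS LETTER, instance**: `Σ_{b∈S} ker₁ b c ≤ ℓ₀ · n⁻⁴ · Σ_σ p σ`, uniformly in the field leg `c`. -/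
theorem scl_fieldMass_le (hn : 1 ≤ n) (hp : ∀ s, 0 ≤ p s) (hrad : ∀ s x', (rad s y x').length ≤ ℓ₀)
    (S : Finset B) (c : Pt) :
    ∑ b ∈ S, ker₁ (sclW n p) (sclFld n y) (sclBg n y rad) b c
      ≤ ((ℓ₀ : ℕ) : ℝ) * (((n : ℝ) ^ 4)⁻¹ * ∑ s, p s) :=
  (sum_ker₁_le_mul_wfld (sclW_nonneg n hp) (length_sclBg_le y hrad) S c).trans
    (mul_le_mul_of_nonneg_left (wfld_scl_le hn y hp c) (Nat.cast_nonneg _))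

/-- [folklore] **SUPPORT, instance**: a nonzero `ker₁ b c` is witnessed by a block site `x′` with `c = n•y + x′` and a rule `σ` whose radial word contains `b`. -/
theorem scl_support {b : B} {c : Pt} (h : ker₁ (sclW n p) (sclFld n y) (sclBg n y rad) b c ≠ 0) :
    ∃ x ∈ fineBlock n, ∃ s : σ, n • y + x = c ∧ b ∈ rad s y x := by
  obtain ⟨e, hc, hb⟩ := exists_of_ker₁_ne_zero h
  exact ⟨e.1.1, e.1.2, e.2, hc, hb⟩

/-! ## §2 The windowed letters (M), (M₂) BY NAME -/

/-- **(L) FOR THE 0-FORM FAMILY** ([folklore]): with a position map `pos : B → Pt` and the DISPLAYED radial radius letter «every letter of a radial word of block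
`u` lies within `R₀·n` of the anchor `n•u`», a nonzero `mass₁` entry of block `u` lies within `R₀·n` of `n•u`. -/
theorem scl_mass₁_local (u : Pt) (pos : B → Pt) {R₀ : ℝ}
    (hradR : ∀ (s : σ) (x : ↥(fineBlock n)) (ℓ : B), ℓ ∈ rad s u x.1 → (supNorm (pos ℓ - (n : ℤ) • u) : ℝ) ≤ R₀ * n) {ℓ : B}
    (h : mass₁ (sclW n p) (sclBg n u rad) ℓ ≠ 0) : (supNorm (pos ℓ - (n : ℤ) • u) : ℝ) ≤ R₀ * n := by
  obtain ⟨e, he⟩ := exists_of_mass₁_ne_zero h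
  exact hradR e.2 e.1 ℓ he

/-- **(M) FOR THE 0-FORM FAMILY, HALF RATE** ([folklore]): the per-block mass functions `mass₁ (sclW n p) (sclBg n u rad)` satisfy RHOA-6c′'s windowed letter with
`Λ = ℓ₀·Σ_σ p σ` (`scl_massFun_le`) and the radius `R₀` of the path rules:
`Σ_{ℓ∈S} e^{−(δ∕(2n))‖pos ℓ − c‖∞}·Σ_{u∈Y} mass₁^{(u)} ℓ ≤ (ℓ₀·Σp)·e^{δR₀∕2}·(e^{δ∕2}·(1 + 480·e^{δ∕4}(4∕δ)⁴))`, ALL finite `S`, `Y`, every centre `c`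
(`WindowedBlockMass.windowedMass_le_half` BY NAME). -/
theorem scl_windowedMass_le_half {δ : ℝ} (hδ : 0 < δ) (hn : 1 ≤ n) (hp : ∀ s, 0 ≤ p s)
    (hrad : ∀ s u x', (rad s u x').length ≤ ℓ₀) (pos : B → Pt) {R₀ : ℝ}
    (hradR : ∀ (s : σ) (u : Pt) (x : ↥(fineBlock n)) (ℓ : B), ℓ ∈ rad s u x.1 → (supNorm (pos ℓ - (n : ℤ) • u) : ℝ) ≤ R₀ * n)
    (S : Finset B) (Y : Finset Pt) (c : Pt) :
    ∑ ℓ ∈ S, Real.exp (-(δ / (2 * n)) * (supNorm (pos ℓ - c) : ℝ)) * ∑ u ∈ Y, mass₁ (sclW n p) (sclBg n u rad) ℓ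
      ≤ (((ℓ₀ : ℕ) : ℝ) * ∑ s, p s) * Real.exp (δ * R₀ / 2) * (Real.exp (δ / 2) * (1 + 480 * Real.exp (δ / 4) * (4 / δ) ^ 4)) :=
  windowedMass_le_half pos hδ hn (m := fun u ℓ => mass₁ (sclW n p) (sclBg n u rad) ℓ)
    (fun _ ℓ => mass₁_nonneg (sclW_nonneg n hp) ℓ)
    (fun u S' => scl_massFun_le hn hp (hrad · u ·) S') (fun u _ h => scl_mass₁_local u pos (fun s x ℓ' h' => hradR s u x ℓ' h') h) S Y c

/-- [folklore] **SUP, second jet, instance**: `count ≤ M` for both letters ⟹ `ker₂ b″ b′ c ≤ 2M²·n⁻⁴·Σ_σ p σ`. -/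
theorem scl_ker₂_sup_le (hn : 1 ≤ n) (hp : ∀ s, 0 ≤ p s) {M : ℕ} {b'' b' : B}
    (hM'' : ∀ e, (sclBg n y rad e).count b'' ≤ M) (hM' : ∀ e, (sclBg n y rad e).count b' ≤ M) (c : Pt) :
    ker₂ (sclW n p) (sclFld n y) (sclBg n y rad) b'' b' c ≤ (2 * (M : ℝ) ^ 2) * (((n : ℝ) ^ 4)⁻¹ * ∑ s, p s) :=
  (ker₂_le_mul_wfld (sclW_nonneg n hp) hM'' hM' c).trans
    (mul_le_mul_of_nonneg_left (wfld_scl_le hn y hp c) (by positivity))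

/-- [folklore] **OUTER-LETTER WINDOW TOTAL per coarse site, second jet, instance**: `Σ_{ℓ∈S} Σ_{b′∈S′} Σ_{c∈T} ker₂ ℓ b′ c ≤ 2ℓ₀·(ℓ₀·Σp)`. -/
theorem scl_ker₂_outer_le (hn : 1 ≤ n) (hp : ∀ s, 0 ≤ p s) (hrad : ∀ s x', (rad s y x').length ≤ ℓ₀)
    (S S' : Finset B) (T : Finset Pt) :
    ∑ b'' ∈ S, ∑ b' ∈ S', ∑ c ∈ T, ker₂ (sclW n p) (sclFld n y) (sclBg n y rad) b'' b' c
      ≤ (2 * ((ℓ₀ : ℕ) : ℝ)) * (((ℓ₀ : ℕ) : ℝ) * ∑ s, p s) := by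
  calc ∑ b'' ∈ S, ∑ b' ∈ S', ∑ c ∈ T, ker₂ (sclW n p) (sclFld n y) (sclBg n y rad) b'' b' c
      ≤ ∑ b'' ∈ S, (2 * ((ℓ₀ : ℕ) : ℝ)) * mass₁ (sclW n p) (sclBg n y rad) b'' :=
        Finset.sum_le_sum fun b'' _ => sum_ker₂_outer_le (sclW_nonneg n hp) (length_sclBg_le y hrad) b'' S' T
    _ = (2 * ((ℓ₀ : ℕ) : ℝ)) * ∑ b'' ∈ S, mass₁ (sclW n p) (sclBg n y rad) b'' := by rw [Finset.mul_sum]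
    _ ≤ _ := mul_le_mul_of_nonneg_left (scl_massFun_le hn hp hrad S) (by positivity)

/-- **(M₂) FOR THE 0-FORM FAMILY, HALF RATE** ([folklore]): the outer-letter marginal of the second-jet kernel, windowed exactly as RHOA-6c′'s (M),
`Σ_{ℓ∈S} e^{−(δ∕(2n))‖pos ℓ − c₀‖∞}·Σ_{u∈Y} (Σ_{b′∈S′}Σ_{c∈T} ker₂^{(u)} ℓ b′ c) ≤ (2ℓ₀·(ℓ₀·Σp))·e^{δR₀∕2}·(e^{δ∕2}·(1 + 480·e^{δ∕4}(4∕δ)⁴))`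
for ALL finite `S`, `S′`, `T`, `Y` and every centre `c₀` (`windowedMass_le_half` with (T) = `scl_ker₂_outer_le`, (L) inherited from `scl_mass₁_local`). -/
theorem scl_windowedMass₂_le_half {δ : ℝ} (hδ : 0 < δ) (hn : 1 ≤ n) (hp : ∀ s, 0 ≤ p s)
    (hrad : ∀ s u x', (rad s u x').length ≤ ℓ₀) (pos : B → Pt) {R₀ : ℝ}
    (hradR : ∀ (s : σ) (u : Pt) (x : ↥(fineBlock n)) (ℓ : B), ℓ ∈ rad s u x.1 → (supNorm (pos ℓ - (n : ℤ) • u) : ℝ) ≤ R₀ * n)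
    (S S' : Finset B) (T Y : Finset Pt) (c₀ : Pt) :
    ∑ ℓ ∈ S, Real.exp (-(δ / (2 * n)) * (supNorm (pos ℓ - c₀) : ℝ)) *
        ∑ u ∈ Y, ∑ b' ∈ S', ∑ c ∈ T, ker₂ (sclW n p) (sclFld n u) (sclBg n u rad) ℓ b' c
      ≤ ((2 * ((ℓ₀ : ℕ) : ℝ)) * (((ℓ₀ : ℕ) : ℝ) * ∑ s, p s)) * Real.exp (δ * R₀ / 2) *
          (Real.exp (δ / 2) * (1 + 480 * Real.exp (δ / 4) * (4 / δ) ^ 4)) := by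
  have hω : ∀ u : Pt, ∀ e : ↥(fineBlock n) × σ, 0 ≤ sclW n p e := fun _ e => sclW_nonneg n hp e
  refine windowedMass_le_half pos hδ hn
    (m := fun u ℓ => ∑ b' ∈ S', ∑ c ∈ T, ker₂ (sclW n p) (sclFld n u) (sclBg n u rad) ℓ b' c)
    (fun u ℓ => Finset.sum_nonneg fun _ _ => Finset.sum_nonneg fun _ _ => ker₂_nonneg (hω u) _ _ _)
    (fun u S₁ => scl_ker₂_outer_le hn hp (hrad · u ·) S₁ S' T) (fun u ℓ hne => ?_) S Y c₀
  -- locality: a nonzero outer marginal forces a nonzero first-jet mass at `ℓ`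
  have hle := sum_ker₂_outer_le (hω u) (length_sclBg_le u (hrad · u ·)) ℓ S' T (fld := sclFld n u)
  have hm : mass₁ (sclW n p) (sclBg n u rad) ℓ ≠ 0 := by
    intro h0
    rw [h0, mul_zero] at hle
    exact hne (le_antisymm hle (Finset.sum_nonneg fun _ _ => Finset.sum_nonneg fun _ _ => ker₂_nonneg (hω u) _ _ _))
  exact scl_mass₁_local u pos (fun s x ℓ' h' => hradR s u x ℓ' h') hm

/-! ## §3 Kernel forms (node 6 BY NAME) -/

omit [DecidableEq B] in
/-- [folklore] THE 0-FORM FAMILY's COVARIANT AVERAGE (node 6 `avgPath` over the block events) has node 6's first-jet stencil as derivative at `0`. -/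
theorem hasDerivAt_sclAvg_zero {𝔸 : Type*} [NormedRing 𝔸] [NormedAlgebra ℝ 𝔸] [CompleteSpace 𝔸] (n : ℕ) (y : Pt)
    (p : σ → ℝ) (rad : σ → Pt → Pt → List B) (β : B → 𝔸) (φ : Pt → 𝔸) :
    HasDerivAt (avgPath ℝ (sclW n p) (fun e => (sclBg n y rad e).map β) (fun e => φ (sclFld n y e)))
      (avgJet₁ ℝ (sclW n p) (fun e => (sclBg n y rad e).map β) (fun e => φ (sclFld n y e))) 0 :=
  hasDerivAt_avgPath_zero ℝ _ _ _

/-- [folklore] THE KERNEL FORM of the first jet for the 0-form family, on any windows containing the letters and the field legs. -/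
theorem sclJet₁_eq_sum_ker₁ {𝔸 : Type*} [NormedRing 𝔸] [NormedAlgebra ℝ 𝔸] (n : ℕ) (y : Pt) (p : σ → ℝ)
    (rad : σ → Pt → Pt → List B) (S : Finset B) (T : Finset Pt) (hS : ∀ e, ∀ b ∈ sclBg n y rad e, b ∈ S)
    (hT : ∀ e : ↥(fineBlock n) × σ, sclFld n y e ∈ T) (β : B → 𝔸) (φ : Pt → 𝔸) :
    avgJet₁ ℝ (sclW n p) (fun e => (sclBg n y rad e).map β) (fun e => φ (sclFld n y e))
      = ∑ b ∈ S, ∑ c ∈ T, ker₁ (sclW n p) (sclFld n y) (sclBg n y rad) b c • (β b * φ c - φ c * β b) :=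
  avgJet₁_eq_sum_ker₁ _ _ _ S T hS hT β φ

/-- [folklore] THE KERNEL FORM of the second jet for the 0-form family (ordered nested double commutators `dc`). -/
theorem sclJet₂_eq_sum_ker₂ {𝔸 : Type*} [NormedRing 𝔸] [NormedAlgebra ℝ 𝔸] (n : ℕ) (y : Pt) (p : σ → ℝ)
    (rad : σ → Pt → Pt → List B) (S : Finset B) (T : Finset Pt) (hS : ∀ e, ∀ b ∈ sclBg n y rad e, b ∈ S)
    (hT : ∀ e : ↥(fineBlock n) × σ, sclFld n y e ∈ T) (β : B → 𝔸) (φ : Pt → 𝔸) :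
    avgJet₂ ℝ (sclW n p) (fun e => (sclBg n y rad e).map β) (fun e => φ (sclFld n y e))
      = ∑ b'' ∈ S, ∑ b' ∈ S, ∑ c ∈ T, ker₂ (sclW n p) (sclFld n y) (sclBg n y rad) b'' b' c • dc (β b'') (β b') (φ c) :=
  avgJet₂_eq_sum_ker₂ _ _ _ S T hS hT β φ

end Scalar

end Summit.QuantumFields.BalabanUV.Beta.FP.ScalarAveragingJetLetters

end
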